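import Literature.NumberTheory.PAdicHodge.TateAlmostEtaleTamePackage
import Literature.NumberTheory.PAdicHodge.TateSenConditionKummerRoute
import HarnessLib

/-!
# The Tate–Sen condition (TS1) for the completed algebraic closure of a `p`-adic field: the discharge

`Proofs`-style sibling (theorems only) of `TateSenConditionCompletedAlgClosure.lean`, closing its named
fact `Literature.NumberTheory.PAdicHodge.tate1967_TS1_completedAlgClosure` — Tate 1967 §3.2 Prop. 9
(the almost étale / trace lemma for the cyclotomic tower of a `p`-adic field, in the cochain form of
Berger–Colmez 2008 Prop. 4.1.1 / (TS1)) — UNCONDITIONALLY, for every non-archimedean local field `F`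
of characteristic `0` and every prime `p` below it.

The proof is the tree's elementary KUMMER ROUTE (no differents, no higher ramification theory, no local
class field theory): the almost-perfectoid package of `K_∞ = ℚ_p(μ_{p^∞})` (`CyclotomicTowerPthPowers`),
its ascent along Kummer `p`-steps (`TateAlmostEtalePackageStep`), `p`-power Galois towers
(`TateAlmostEtalePTower`, `TateAlmostEtalePChain`), root-of-unity steps (`TateAlmostEtaleEtaleStep`) and
prime radical steps (`TateAlmostEtaleRadicalDifferent`, `TateAlmostEtaleRadicalPackage`), the Sylow /
Galois-closure dévissage and the bridge to the cochain form (`TateAlmostEtaleSylow`,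
`TateSenConditionOfAlmostEtale`, `TateSenConditionKummerRoute.tate1967_TS1_of_tame`), and the last
hypothesis (C) of that reduction — finite extensions of `K_∞` of degree prime to `p` are
almost-perfectoid — by the tame structure theorem (`TateTameValueGroup`, `TateTameTeichmuller`,
`TateAlmostEtalePrincipalUnitRoots`, `TateTameStructure`, `TateAlmostEtaleTamePackage.tamePackage`).

Consumers unblocked: every `H¹` statement of Tate 1967 §3.3 in the tree (`TateSenCocycles`,
`TateTwistedCocycle`, `TateTwistedH1Vanishing`, `TateH1OfKerVanishing`), Kato's `H¹(K, B_dR)` dévissage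
(`TateH1BdRFilOfTS1.kato1993_H1_bdRFil_of_TS1`) and the dual-exponential surjectivity
(`BdRH1Devissage.hasDualExp_of_isDeRham_of_TS1`), hence the conditional closers of crux K★ of route
`EdixhovenFibreFiveSeven` no longer depend on (TS1) or on Scholze 2012 Thm. 3.7.

## References

* J. Tate, *p-divisible groups*, Proc. Conf. Local Fields (Driebergen 1966), Springer 1967, §3.2
  Prop. 9, Prop. 10. [Tate1967]
* L. Berger, P. Colmez, *Familles de représentations de de Rham et monodromie p-adique*, Astérisque 319
  (2008), Prop. 4.1.1, Cor. 3.2.2. [BergerColmez2008]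
* S. Lang, *Algebraic Number Theory*, Ch. II §5 Prop. 12. [LangANT1994]
-/

noncomputable section

namespace Literature.NumberTheory.PAdicHodge

/-- **The Tate–Sen condition (TS1) holds** — `tate1967_TS1_completedAlgClosure` is a theorem: for every
non-archimedean local field `F` of characteristic `0` and residue characteristic `p`, there is a constant
`K` such that for all open subgroups `H₁ ≤ H₂` of `H₀ = ker χ ≤ Gal(F̄/ℚ_p)` and every system `S` of
representatives of `H₂/H₁` there is `α ∈ ℂ_F^{H₁}` with `‖α‖ ≤ K` and `Σ_{s ∈ S} s • α = 1`. Proof: the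
tree's Kummer-route reduction `TateAlmostEtale.tate1967_TS1_of_tame` applied to the tame package
`TateAlmostEtale.tamePackage`. [cite: Tate1967, §3.2 Prop. 9] [cite: BergerColmez2008, Prop. 4.1.1] -/
theorem tate1967_TS1_completedAlgClosure_holds : tate1967_TS1_completedAlgClosure :=
  TateAlmostEtale.tate1967_TS1_of_tame fun hp T hfin hd => TateAlmostEtale.tamePackage hp T hfin hd

end Literature.NumberTheory.PAdicHodge

end
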